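import Summits.ResolutionOfSingularities.ResolutionOfSingularities.Theorems.FrobeniusLadderFInjectiveMacaulayficationFHalfRowOfProductCentre
import Summits.ResolutionOfSingularities.ResolutionOfSingularities.Theorems.FrobeniusLadderFInjectiveMacaulayficationLx3p3PointKBlowupFull
import Summits.ResolutionOfSingularities.ResolutionOfSingularities.Theorems.FrobeniusLadderFInjectiveMacaulayficationLx3p3PointFloor
import HarnessLib

/-!
# BED T: THE POINT FLOOR OF lx3p3 = `z² + x⁴z + y⁴ + u⁴ + t⁵` (char 3) IS CURED BY ONE FIBRE-SUPPORTED BLOWING UP — and the TWO-SIDED ROW ★ `f4pos_p3_rowT` = ⟨legal, not full, cured⟩,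
# the SECOND characteristic-3 row of the F-half census
# (crux `FInjectiveMacaulayfication` stmt-ResolutionOfSingularities-15315, chain w45a; res-L1-w45a-plan-1 RULINGs R21.38 (2) / R21.39 (2) «BED T by cells, no new glue; stub-3
# assembles the row»; seat res-L1-w45a-stub-3 g11; input side = `Lx3p3PointFloor` (this seat); cure = res-L1-w45a-stub-2 g9's 𝔪·K product certificate 9e1742bf7fecb8ad
# (17-chart positive-ray thin-cell fan; modules `Lx3p3PointKChar3Fan{Tables,Checks,}` authored by stub-2 g9) via ✓ `Lx3p3PointKBlowupFull.hrow_lx3p3` (this seat, template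
# ✓p659639); specimen facts `Lx3p3Specimen` (res-L1-w45a-stub-1 g12); Newton non-degeneracy `Lx3p3Newton` is NOT used — the bed is not convenient in `x`, so no Σ_f-refining
# 𝔪-primary fan exists (R21.39 (1)); template = ✓p660468 `P3d4z4557PointFloorRow`)

[OURS · L1 W4.5a] Support file (`--supports stmt-ResolutionOfSingularities-15315 --as helper`); def-free, unconditional; replaces the role of NO printed item;
NOT a statement of the manuscript; AI-written (AI review is weaker than expert review).

`X = Spec (k[X₀..X₄]/(f))`, `f = X4 ^ 2 + X0 ^ 4 * X4 + X1 ^ 4 + X2 ^ 4 + X3 ^ 5` (`z² + x⁴z + y⁴ + u⁴ + t⁵`), `char k = 3` (any field), `v` = the vertex (isolated singular point,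
NOT F-pure: `f² ∈ 𝔪^[3]`), floor centre `𝔪 = (x̄, ȳ, ū, t̄, z̄)`. THEN (§1 `pointFloor_lx3p3_row`): for EVERY blowing up `g : S′ → Spec 𝒪_{X,v}` along `𝔪·𝒪_{X,v}` there is
`𝓚 ≠ ⊥` on `S′`, supported over the closed point, ALL of whose blowings up are FULL at every stalk — ONE term on this seat's generic
`FHalfRowOfProductCentre.fHalfConclusion_of_affineBlowup_mul` (p618085 §2) over `Lx3p3PointKBlowupFull.hrow_lx3p3` (the blow-up of `X` along `𝔪·K` is FULL at every point:
17 charts, thin Fedder cells everywhere, `K` = 47 monomials). §2 ★ `f4pos_p3_rowT` conjoins it with the input legality and non-FULLness (`Lx3p3PointFloor`):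
LEGAL ∧ NOT F(4)-iso (p = 3) ∧ CURED for the refuting floor — the second two-sided row of the census at p = 3 (after ✓p660468 `f4pos_row_p3_one`, BED W).
[OURS · certificate instance + assembly of landed theorems] [cite: StacksProject, Tag 080A] [cite: GortzWedhorn2020, Prop. 13.92]
-/

-- single-problem summit: the doubled namespace component is forced
set_option linter.dupNamespace false

noncomputable section

open AlgebraicGeometry CategoryTheory Literature.AlgebraicGeometry.Resolution TopologicalSpace IsLocalRing MvPolynomial

namespace Summit.ResolutionOfSingularities.ResolutionOfSingularities.Theorems.FInjectiveMacaulayfication.Lx3p3PointFloorRow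

open Summit.ResolutionOfSingularities.ResolutionOfSingularities.Theorems.FInjectiveMacaulayfication
open SliceableCentre

/-! ## §1 The cure -/

/-- ★★★ **THE BED T (lx3p3) POINT FLOOR IS CURED, UNCONDITIONAL.** See the module docstring. [OURS · certificate instance] [cite: StacksProject, Tag 080A] -/
theorem pointFloor_lx3p3_row (k : Type) [Field k] [CharP k 3] (f : MvPolynomial (Fin 5) k)
    (hf : f = X 4 ^ 2 + X 0 ^ 4 * X 4 + X 1 ^ 4 + X 2 ^ 4 + X 3 ^ 5)
    (v : Spec (.of (MvPolynomial (Fin 5) k ⧸ Ideal.span {f})))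
    (hv : v.asIdeal = Ideal.span (Set.range (fun j : Fin 5 => Ideal.Quotient.mk (Ideal.span {f}) (X j)))) :
    ∀ (S' : Scheme.{0}) (g : S' ⟶ Spec ((Spec (.of (MvPolynomial (Fin 5) k ⧸ Ideal.span {f}))).presheaf.stalk v)),
      IsBlowup g ((affineBlowup.idealSheaf (Ideal.span (Set.range (fun j : Fin 5 => Ideal.Quotient.mk (Ideal.span {f}) (X j))))).comap
        ((Spec (.of (MvPolynomial (Fin 5) k ⧸ Ideal.span {f}))).fromSpecStalk v)) →
      ∃ 𝓚 : S'.IdealSheafData, 𝓚 ≠ ⊥ ∧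
        (∀ s ∈ (𝓚.support : Set S'), g.base s = closedPoint ((Spec (.of (MvPolynomial (Fin 5) k ⧸ Ideal.span {f}))).presheaf.stalk v)) ∧
        ∀ (S'' : Scheme.{0}) (π : S'' ⟶ S'), IsBlowup π 𝓚 → ∀ s : S'', FullCl 3 (S''.presheaf.stalk s) := by
  haveI hp : (Ideal.span {f}).IsPrime :=
    (Ideal.span_singleton_prime (Lx3p3Specimen.prime_f k f hf).ne_zero).mpr (Lx3p3Specimen.prime_f k f hf)
  haveI : IsDomain (MvPolynomial (Fin 5) k ⧸ Ideal.span {f}) := Ideal.Quotient.isDomain _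
  exact FHalfRowOfProductCentre.fHalfConclusion_of_affineBlowup_mul 3 _ _ (Lx3p3PointKBlowupFull.span_floor_ne_bot k f hf)
    (Lx3p3PointKBlowupFull.span_KA_ne_bot k f hf) v (by rw [hv]; exact Lx3p3PointKBlowupFull.span_range_X_le_radical_span_KA k f)
    (Lx3p3PointKBlowupFull.hrow_lx3p3 k f hf)

/-! ## §2 The two-sided row -/

/-- ★★★ **THE SECOND p = 3 ROW (BED T = the lx3p3 POINT FLOOR) AS ONE KERNEL THEOREM: LEGAL ∧ NOT F(4)-iso (p = 3) ∧ CURED.** For every blowing up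
`g : S′ → Spec 𝒪_{X,v}` along `I = 𝔪̃|_{Spec 𝒪_{X,v}}`: (legal) `I ≠ ⊥`, `Supp I ⊆ (Reg)ᶜ`, `S′` regular off the closed fibre and CM everywhere; (NOT F(4)-iso (p = 3)) some stalk
of `S′` over the closed point is NOT FULL; (cured, §1) there is `𝓚 ≠ ⊥` on `S′`, supported over the closed point, ALL of whose blowings up are FULL at every stalk.
[OURS · assembly of landed theorems] -/
theorem f4pos_p3_rowT (k : Type) [Field k] [CharP k 3] (f : MvPolynomial (Fin 5) k) (hf : f = X 4 ^ 2 + X 0 ^ 4 * X 4 + X 1 ^ 4 + X 2 ^ 4 + X 3 ^ 5)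
    (v : Spec (.of (MvPolynomial (Fin 5) k ⧸ Ideal.span {f})))
    (hv : v.asIdeal = Ideal.span (Set.range (fun j : Fin 5 => Ideal.Quotient.mk (Ideal.span {f}) (X j))))
    (S' : Scheme.{0}) (g : S' ⟶ Spec ((Spec (.of (MvPolynomial (Fin 5) k ⧸ Ideal.span {f}))).presheaf.stalk v))
    (hg : IsBlowup g ((affineBlowup.idealSheaf (Ideal.span (Set.range (fun j : Fin 5 => Ideal.Quotient.mk (Ideal.span {f}) (X j))))).comap
      ((Spec (.of (MvPolynomial (Fin 5) k ⧸ Ideal.span {f}))).fromSpecStalk v))) :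
    (((affineBlowup.idealSheaf (Ideal.span (Set.range (fun j : Fin 5 => Ideal.Quotient.mk (Ideal.span {f}) (X j))))).comap
        ((Spec (.of (MvPolynomial (Fin 5) k ⧸ Ideal.span {f}))).fromSpecStalk v)) ≠ ⊥ ∧
      (((((affineBlowup.idealSheaf (Ideal.span (Set.range (fun j : Fin 5 => Ideal.Quotient.mk (Ideal.span {f}) (X j))))).comap
        ((Spec (.of (MvPolynomial (Fin 5) k ⧸ Ideal.span {f}))).fromSpecStalk v))).support :
          Set (Spec ((Spec (.of (MvPolynomial (Fin 5) k ⧸ Ideal.span {f}))).presheaf.stalk v))) ⊆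
        (Scheme.regularLocus (Spec ((Spec (.of (MvPolynomial (Fin 5) k ⧸ Ideal.span {f}))).presheaf.stalk v)))ᶜ) ∧
      (∀ s : S', g.base s ≠ closedPoint ((Spec (.of (MvPolynomial (Fin 5) k ⧸ Ideal.span {f}))).presheaf.stalk v) → s ∈ Scheme.regularLocus S') ∧
      (∀ s : S', CMCl (S'.presheaf.stalk s))) ∧
    (∃ s : S', g.base s = closedPoint ((Spec (.of (MvPolynomial (Fin 5) k ⧸ Ideal.span {f}))).presheaf.stalk v) ∧ ¬ FullCl 3 (S'.presheaf.stalk s)) ∧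
    (∃ 𝓚 : S'.IdealSheafData, 𝓚 ≠ ⊥ ∧
      (∀ s ∈ (𝓚.support : Set S'), g.base s = closedPoint ((Spec (.of (MvPolynomial (Fin 5) k ⧸ Ideal.span {f}))).presheaf.stalk v)) ∧
      ∀ (S'' : Scheme.{0}) (π : S'' ⟶ S'), IsBlowup π 𝓚 → ∀ s : S'', FullCl 3 (S''.presheaf.stalk s)) :=
  ⟨Lx3p3PointFloor.pointFloor_lx3p3_input_legal k f hf v hv S' g hg, Lx3p3PointFloor.pointFloor_lx3p3_not_full k f hf v hv S' g hg,
    pointFloor_lx3p3_row k f hf v hv S' g hg⟩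

end Summit.ResolutionOfSingularities.ResolutionOfSingularities.Theorems.FInjectiveMacaulayfication.Lx3p3PointFloorRow

end
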